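/-
Copyright (c) 2026. All rights reserved.
Released under Apache 2.0 license as described in the file LICENSE.
Authors: HodgeCM publication cell (pub-hodgecm), model-construction sub-cell, construction prover `mc-weil-1`.
-/
import Literature.RepresentationTheory.HeisenbergGroup.RankOneGeneration

/-!
# Rank one: the integral points `SL₂(𝒪)`, their generation, and the unramified vector `1_𝒪`

Topic `RepresentationTheory/HeisenbergGroup`; namespace `Literature.RepresentationTheory.HeisenbergGroup`.

KERNEL throughout; no records. `F` a non-archimedean local field, `𝒪 = 𝔭⁰ = primePowBall F 0`, `W = F × F`.
* §1 entries of products and inverses in `Sp(W) = SL₂(F)` (`entryA_mul`, …, `entryA_inv`, …) and the subgroup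
  `integralSp₁ F = SL₂(𝒪) = {g | a, b, c, d ∈ 𝒪}`;
* §2 **generation of `SL₂(𝒪)` over the LOCAL ring `𝒪`** by the unit Levi elements `m(t)` (`|t| = 1`), the integral
  lower unipotents `n(s)` (`s ∈ 𝒪`) and `w` (`closure_integralGenerators_eq`): if `|c| = 1` the rank-one Bruhat
  formula has integral factors, else `|a| = 1` (ultrametric inequality on `ad - bc = 1`) and `w⁻¹ g` has unit `c`;
* §3 `fixingPairs ρ φ` (pairs `(g, M) ∈ S̃p_ψ(W)` with `M φ = φ`, a subgroup) and the closure principle;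
* §4 **the unramified vector**: for `ψ` of conductor `𝒪` (`ψ.HasConductorExp 0`), `μ` self-dual (then `μ(𝒪) = 1`,
  `measureReal_ball_eq_one_of_isSelfDualMeasure`) and `2 ∈ 𝒪ˣ` (`⅟2 ∈ 𝒪`), every `g ∈ SL₂(𝒪)` has an implementer
  `M` (MVW (A)) with `M 1_𝒪 = 1_𝒪` (`exists_implementer_fixing_unramifiedVector`): the pairs `(g, M)` with
  `M 1_𝒪 = 1_𝒪` form a subgroup of `S̃p_ψ(W)` whose image contains the three kinds of generators (Levi: `|t⁻¹u| = |u|`;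
  unipotent: `ψ(-½ s u²) = 1` on `𝒪`; Weyl: `(1_𝒪)^ = μ(𝒪) 1_𝒪`, the tree's `fourierSB_indicator_primePowBall`).
  This is the rank-one case of the "unramified vector fixed by `K_v` for almost all `v`" input of the restricted
  tensor product `⊗'_v ω_v` (MVW Chap. 2 II.10; Howe).
-/

set_option autoImplicit false

noncomputable section

namespace Literature.RepresentationTheory.HeisenbergGroup

open _root_.MeasureTheory
open scoped NNReal
open Literature.NumberTheory.Automorphic
open Literature.NumberTheory.GaloisRepresentations.IsNonarchimedeanLocalField

/-! ## §1 Entries of products and inverses; `SL₂(𝒪)` -/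

section Entries

variable {F : Type*} [Field F]

local notation "Sp₁" => symplecticGroup (polar (LinearMap.mul F F))

/-- `a(gh) = a_g a_h + b_g c_h`. [folklore] -/
theorem entryA_mul (g h : Sp₁) : entryA (g * h) = entryA g * entryA h + entryB g * entryC h := by
  show (((g : (F × F) ≃ₗ[F] (F × F)) * (h : (F × F) ≃ₗ[F] (F × F))) (1, 0)).1 = _
  rw [LinearEquiv.mul_apply, apply_eq_entries g]; rfl

/-- `b(gh) = a_g b_h + b_g d_h`. [folklore] -/
theorem entryB_mul (g h : Sp₁) : entryB (g * h) = entryA g * entryB h + entryB g * entryD h := by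
  show (((g : (F × F) ≃ₗ[F] (F × F)) * (h : (F × F) ≃ₗ[F] (F × F))) (0, 1)).1 = _
  rw [LinearEquiv.mul_apply, apply_eq_entries g]; rfl

/-- `c(gh) = c_g a_h + d_g c_h`. [folklore] -/
theorem entryC_mul (g h : Sp₁) : entryC (g * h) = entryC g * entryA h + entryD g * entryC h := by
  show (((g : (F × F) ≃ₗ[F] (F × F)) * (h : (F × F) ≃ₗ[F] (F × F))) (1, 0)).2 = _
  rw [LinearEquiv.mul_apply, apply_eq_entries g]; rfl

/-- `d(gh) = c_g b_h + d_g d_h`. [folklore] -/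
theorem entryD_mul (g h : Sp₁) : entryD (g * h) = entryC g * entryB h + entryD g * entryD h := by
  show (((g : (F × F) ≃ₗ[F] (F × F)) * (h : (F × F) ≃ₗ[F] (F × F))) (0, 1)).2 = _
  rw [LinearEquiv.mul_apply, apply_eq_entries g]; rfl

/-- `g⁻¹ (x, y) = (d x - b y, -c x + a y)`. [folklore] -/
theorem apply_inv_eq_entries (g : Sp₁) (p : F × F) :
    ((g⁻¹ : Sp₁) : (F × F) ≃ₗ[F] (F × F)) p
      = (entryD g * p.1 - entryB g * p.2, -entryC g * p.1 + entryA g * p.2) := by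
  have hdet := det_entries g
  apply (g : (F × F) ≃ₗ[F] (F × F)).injective
  have h1 : (g : (F × F) ≃ₗ[F] (F × F)) (((g⁻¹ : Sp₁) : (F × F) ≃ₗ[F] (F × F)) p) = p := by
    rw [← LinearEquiv.mul_apply, ← Subgroup.coe_mul, mul_inv_cancel, Subgroup.coe_one]; rfl
  rw [h1, apply_eq_entries]
  ext
  · simp only; linear_combination (-p.1) * hdet
  · simp only; linear_combination (-p.2) * hdet

/-- `a(g⁻¹) = d`. [folklore] -/
theorem entryA_inv (g : Sp₁) : entryA g⁻¹ = entryD g := by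
  show ((((g⁻¹ : Sp₁) : (F × F) ≃ₗ[F] (F × F))) (1, 0)).1 = _
  rw [apply_inv_eq_entries]; simp

/-- `b(g⁻¹) = -b`. [folklore] -/
theorem entryB_inv (g : Sp₁) : entryB g⁻¹ = -entryB g := by
  show ((((g⁻¹ : Sp₁) : (F × F) ≃ₗ[F] (F × F))) (0, 1)).1 = _
  rw [apply_inv_eq_entries]; simp

/-- `c(g⁻¹) = -c`. [folklore] -/
theorem entryC_inv (g : Sp₁) : entryC g⁻¹ = -entryC g := by
  show ((((g⁻¹ : Sp₁) : (F × F) ≃ₗ[F] (F × F))) (1, 0)).2 = _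
  rw [apply_inv_eq_entries]; simp

/-- `d(g⁻¹) = a`. [folklore] -/
theorem entryD_inv (g : Sp₁) : entryD g⁻¹ = entryA g := by
  show ((((g⁻¹ : Sp₁) : (F × F) ≃ₗ[F] (F × F))) (0, 1)).2 = _
  rw [apply_inv_eq_entries]; simp

/-- entries of `m(t)`. [folklore] -/
theorem entries_leviSp₁ (t : Fˣ) :
    entryA (leviSp₁ t) = t ∧ entryB (leviSp₁ t) = 0 ∧ entryC (leviSp₁ t) = 0 ∧ entryD (leviSp₁ t) = (t : F)⁻¹ := by
  refine ⟨?_, ?_, ?_, ?_⟩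
  · show (((leviSp₁ t : Sp₁) : (F × F) ≃ₗ[F] (F × F)) (1, 0)).1 = _; rw [coe_leviSp₁_apply]; simp
  · show (((leviSp₁ t : Sp₁) : (F × F) ≃ₗ[F] (F × F)) (0, 1)).1 = _; rw [coe_leviSp₁_apply]; simp
  · show (((leviSp₁ t : Sp₁) : (F × F) ≃ₗ[F] (F × F)) (1, 0)).2 = _; rw [coe_leviSp₁_apply]; simp
  · show (((leviSp₁ t : Sp₁) : (F × F) ≃ₗ[F] (F × F)) (0, 1)).2 = _; rw [coe_leviSp₁_apply]; simp

omit [Field F] in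
/-- entries of `w`. [folklore] -/
theorem entries_weylSp₁ [Field F] :
    entryA (weylSp₁ (F := F)) = 0 ∧ entryB (weylSp₁ (F := F)) = 1 ∧ entryC (weylSp₁ (F := F)) = -1
      ∧ entryD (weylSp₁ (F := F)) = 0 := by
  refine ⟨rfl, rfl, ?_, ?_⟩
  · show -(1 : F) = -1; rfl
  · show -(0 : F) = 0; exact neg_zero

variable [Invertible (2 : F)]

/-- entries of `n(s)`. [folklore] -/
theorem entries_unipSp₁ (s : F) :
    entryA (unipSp₁ s) = 1 ∧ entryB (unipSp₁ s) = 0 ∧ entryC (unipSp₁ s) = s ∧ entryD (unipSp₁ s) = 1 := by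
  refine ⟨?_, ?_, ?_, ?_⟩
  · show (((unipSp₁ s : Sp₁) : (F × F) ≃ₗ[F] (F × F)) (1, 0)).1 = _; rw [coe_unipSp₁_apply]
  · show (((unipSp₁ s : Sp₁) : (F × F) ≃ₗ[F] (F × F)) (0, 1)).1 = _; rw [coe_unipSp₁_apply]
  · show (((unipSp₁ s : Sp₁) : (F × F) ≃ₗ[F] (F × F)) (1, 0)).2 = _; rw [coe_unipSp₁_apply]; simp
  · show (((unipSp₁ s : Sp₁) : (F × F) ≃ₗ[F] (F × F)) (0, 1)).2 = _; rw [coe_unipSp₁_apply]; simp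

end Entries

section Integral

variable {F : Type*} [Field F] [ValuativeRel F] [TopologicalSpace F] [IsNonarchimedeanLocalField F]

local notation "Sp₁" => symplecticGroup (polar (LinearMap.mul F F))
local notation "𝒪₀" => primePowBall F 0

/-- `x ∈ 𝒪 ↔ |x| ≤ 1`. [folklore] -/
theorem mem_ball_zero_iff {x : F} : x ∈ 𝒪₀ ↔ normAbs F x ≤ 1 := by
  rw [mem_primePowBall_iff, zpow_zero]

/-- `1 ∈ 𝒪`. [folklore] -/
theorem one_mem_ball_zero : (1 : F) ∈ 𝒪₀ := by
  rw [mem_ball_zero_iff, map_one]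

/-- `𝒪` is closed under multiplication. [folklore] -/
theorem mul_mem_ball_zero {x y : F} (hx : x ∈ 𝒪₀) (hy : y ∈ 𝒪₀) : x * y ∈ 𝒪₀ := by
  rw [mem_ball_zero_iff] at hx hy ⊢
  rw [map_mul]
  exact mul_le_one' hx hy

/-- `𝒪` is closed under subtraction. [folklore] -/
theorem sub_mem_ball_zero {x y : F} (hx : x ∈ 𝒪₀) (hy : y ∈ 𝒪₀) : x - y ∈ 𝒪₀ := by
  rw [sub_eq_add_neg]; exact add_mem_primePowBall hx (neg_mem_primePowBall hy)

/-- a unit `t` (`|t| = 1`) lies in `𝒪`. [folklore] -/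
theorem mem_ball_zero_of_normAbs_eq_one {t : F} (ht : normAbs F t = 1) : t ∈ 𝒪₀ := by
  rw [mem_ball_zero_iff, ht]

/-- the inverse of a unit is a unit. [folklore] -/
theorem normAbs_inv_eq_one {t : F} (ht : normAbs F t = 1) : normAbs F t⁻¹ = 1 := by
  rw [map_inv₀, ht, inv_one]

/-- multiplication by a unit preserves `𝒪`-membership. [folklore] -/
theorem unit_mul_mem_ball_zero_iff {t : F} (ht : normAbs F t = 1) (x : F) : t * x ∈ 𝒪₀ ↔ x ∈ 𝒪₀ := by
  rw [mem_ball_zero_iff, mem_ball_zero_iff, map_mul, ht, one_mul]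

/-- quotient by a unit. [folklore] -/
theorem div_mem_ball_zero {x c : F} (hx : x ∈ 𝒪₀) (hc : normAbs F c = 1) : x / c ∈ 𝒪₀ := by
  rw [div_eq_mul_inv, mul_comm, unit_mul_mem_ball_zero_iff (normAbs_inv_eq_one hc)]; exact hx

variable (F) in
/-- **`SL₂(𝒪)`**: the elements of `Sp(W) = SL₂(F)` with integral entries (the inverse `(d, -b, -c, a)` is then
integral as well). [cite: MoeglinVignerasWaldspurger1987, Chap. 2 II.10] -/
def integralSp₁ : Subgroup (symplecticGroup (polar (LinearMap.mul F F))) where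
  carrier := {g | entryA g ∈ 𝒪₀ ∧ entryB g ∈ 𝒪₀ ∧ entryC g ∈ 𝒪₀ ∧ entryD g ∈ 𝒪₀}
  mul_mem' := by
    rintro g h ⟨ha, hb, hc, hd⟩ ⟨ha', hb', hc', hd'⟩
    refine ⟨?_, ?_, ?_, ?_⟩
    · show entryA (g * h) ∈ 𝒪₀
      rw [entryA_mul]; exact add_mem_primePowBall (mul_mem_ball_zero ha ha') (mul_mem_ball_zero hb hc')
    · show entryB (g * h) ∈ 𝒪₀
      rw [entryB_mul]; exact add_mem_primePowBall (mul_mem_ball_zero ha hb') (mul_mem_ball_zero hb hd')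
    · show entryC (g * h) ∈ 𝒪₀
      rw [entryC_mul]; exact add_mem_primePowBall (mul_mem_ball_zero hc ha') (mul_mem_ball_zero hd hc')
    · show entryD (g * h) ∈ 𝒪₀
      rw [entryD_mul]; exact add_mem_primePowBall (mul_mem_ball_zero hc hb') (mul_mem_ball_zero hd hd')
  one_mem' := by
    refine ⟨?_, ?_, ?_, ?_⟩
    · show ((1 : (F × F) ≃ₗ[F] (F × F)) (1, 0)).1 ∈ 𝒪₀; exact one_mem_ball_zero
    · show ((1 : (F × F) ≃ₗ[F] (F × F)) (0, 1)).1 ∈ 𝒪₀; exact zero_mem_primePowBall 0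
    · show ((1 : (F × F) ≃ₗ[F] (F × F)) (1, 0)).2 ∈ 𝒪₀; exact zero_mem_primePowBall 0
    · show ((1 : (F × F) ≃ₗ[F] (F × F)) (0, 1)).2 ∈ 𝒪₀; exact one_mem_ball_zero
  inv_mem' := by
    rintro g ⟨ha, hb, hc, hd⟩
    refine ⟨?_, ?_, ?_, ?_⟩
    · show entryA g⁻¹ ∈ 𝒪₀
      rw [entryA_inv]; exact hd
    · show entryB g⁻¹ ∈ 𝒪₀
      rw [entryB_inv]; exact neg_mem_primePowBall hb
    · show entryC g⁻¹ ∈ 𝒪₀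
      rw [entryC_inv]; exact neg_mem_primePowBall hc
    · show entryD g⁻¹ ∈ 𝒪₀
      rw [entryD_inv]; exact ha

/-- membership. [cite: MoeglinVignerasWaldspurger1987, Chap. 2 II.10] -/
theorem mem_integralSp₁ (g : Sp₁) :
    g ∈ integralSp₁ F ↔ entryA g ∈ 𝒪₀ ∧ entryB g ∈ 𝒪₀ ∧ entryC g ∈ 𝒪₀ ∧ entryD g ∈ 𝒪₀ := Iff.rfl

/-- `m(t) ∈ SL₂(𝒪)` for `|t| = 1`. [folklore] -/
theorem leviSp₁_mem_integralSp₁ {t : Fˣ} (ht : normAbs F (t : F) = 1) : leviSp₁ t ∈ integralSp₁ F := by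
  obtain ⟨h1, h2, h3, h4⟩ := entries_leviSp₁ t
  rw [mem_integralSp₁, h1, h2, h3, h4]
  exact ⟨mem_ball_zero_of_normAbs_eq_one ht, zero_mem_primePowBall 0, zero_mem_primePowBall 0,
    mem_ball_zero_of_normAbs_eq_one (normAbs_inv_eq_one ht)⟩

/-- `w ∈ SL₂(𝒪)`. [folklore] -/
theorem weylSp₁_mem_integralSp₁ : weylSp₁ ∈ integralSp₁ F := by
  obtain ⟨h1, h2, h3, h4⟩ := entries_weylSp₁ (F := F)
  rw [mem_integralSp₁, h1, h2, h3, h4]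
  exact ⟨zero_mem_primePowBall 0, one_mem_ball_zero, neg_mem_primePowBall one_mem_ball_zero, zero_mem_primePowBall 0⟩

variable [Invertible (2 : F)]

/-- `n(s) ∈ SL₂(𝒪)` for `s ∈ 𝒪`. [folklore] -/
theorem unipSp₁_mem_integralSp₁ {s : F} (hs : s ∈ 𝒪₀) : unipSp₁ s ∈ integralSp₁ F := by
  obtain ⟨h1, h2, h3, h4⟩ := entries_unipSp₁ s
  rw [mem_integralSp₁, h1, h2, h3, h4]
  exact ⟨one_mem_ball_zero, zero_mem_primePowBall 0, hs, one_mem_ball_zero⟩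

/-! ## §2 Generation of `SL₂(𝒪)` -/

variable (F) in
/-- the integral generators: unit Levi elements, integral lower unipotents, `w`. [folklore] -/
def integralGenerators : Set (symplecticGroup (polar (LinearMap.mul F F))) :=
  {g | ∃ t : Fˣ, normAbs F (t : F) = 1 ∧ g = leviSp₁ t} ∪ {g | ∃ s ∈ 𝒪₀, g = unipSp₁ s} ∪ {weylSp₁}

/-- the integral generators lie in `SL₂(𝒪)`. [folklore] -/
theorem integralGenerators_subset : integralGenerators F ⊆ (integralSp₁ F : Set Sp₁) := by
  rintro g ((⟨t, ht, rfl⟩ | ⟨s, hs, rfl⟩) | hg)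
  · exact leviSp₁_mem_integralSp₁ ht
  · exact unipSp₁_mem_integralSp₁ hs
  · rw [Set.mem_singleton_iff] at hg; subst hg; exact weylSp₁_mem_integralSp₁

omit [Invertible (2 : F)] in
/-- on `SL₂(𝒪)`, if `c` is not a unit then `a` is: `1 = |ad - bc| ≤ max (|a||d|, |b||c|)` with `|b||c| < 1`.
[folklore] -/
theorem normAbs_entryA_eq_one {g : Sp₁} (hg : g ∈ integralSp₁ F) (hc : normAbs F (entryC g) < 1) :
    normAbs F (entryA g) = 1 := by
  obtain ⟨ha, hb, -, hd⟩ := hg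
  rw [mem_ball_zero_iff] at ha hb hd
  have hdet := det_entries g
  have h1 : (1 : ℝ≥0) ≤ max (normAbs F (entryA g * entryD g)) (normAbs F (entryB g * entryC g)) := by
    have := normAbs_add_le_max (entryA g * entryD g) (-(entryB g * entryC g))
    rw [← sub_eq_add_neg, hdet, map_one, normAbs_neg] at this
    exact this
  have h2 : normAbs F (entryB g * entryC g) < 1 := by
    rw [map_mul]
    calc normAbs F (entryB g) * normAbs F (entryC g) ≤ 1 * normAbs F (entryC g) :=
          mul_le_mul_of_nonneg_right hb zero_le
      _ < 1 := by rw [one_mul]; exact hc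
  have h3 : (1 : ℝ≥0) ≤ normAbs F (entryA g * entryD g) := by
    rcases le_max_iff.1 h1 with h | h
    · exact h
    · exact absurd h (not_le.2 h2)
  rw [map_mul] at h3
  refine le_antisymm ha ?_
  calc (1 : ℝ≥0) ≤ normAbs F (entryA g) * normAbs F (entryD g) := h3
    _ ≤ normAbs F (entryA g) * 1 := mul_le_mul_of_nonneg_left hd zero_le
    _ = normAbs F (entryA g) := mul_one _

/-- **`SL₂(𝒪)` is generated by the unit Levi elements, the integral lower unipotents and `w`** (a local-ring
Bruhat argument). [folklore] -/
theorem closure_integralGenerators_eq : Subgroup.closure (integralGenerators F) = integralSp₁ F := by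
  refine le_antisymm ((Subgroup.closure_le _).2 integralGenerators_subset) ?_
  intro g hg
  set H := Subgroup.closure (integralGenerators F) with hH
  have hL : ∀ t : Fˣ, normAbs F (t : F) = 1 → leviSp₁ t ∈ H := fun t ht =>
    Subgroup.subset_closure (Or.inl (Or.inl ⟨t, ht, rfl⟩))
  have hU : ∀ s ∈ 𝒪₀, unipSp₁ s ∈ H := fun s hs => Subgroup.subset_closure (Or.inl (Or.inr ⟨s, hs, rfl⟩))
  have hW : weylSp₁ ∈ H := Subgroup.subset_closure (Or.inr rfl)
  have hV : ∀ s ∈ 𝒪₀, upperSp₁ s ∈ H := fun s hs =>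
    H.mul_mem (H.mul_mem hW (hU _ (neg_mem_primePowBall hs))) (H.inv_mem hW)
  -- the big cell with unit `c`
  have cell : ∀ g' : Sp₁, g' ∈ integralSp₁ F → normAbs F (entryC g') = 1 → g' ∈ H := by
    intro g' hg' hc
    obtain ⟨ha, -, -, hd⟩ := hg'
    have hc0 : entryC g' ≠ 0 := fun h => by rw [h, map_zero] at hc; exact zero_ne_one hc
    rw [eq_bruhat_of_entryC_ne_zero g' hc0]
    refine H.mul_mem (H.mul_mem (H.mul_mem (hV _ (div_mem_ball_zero ha hc)) (hL _ ?_)) hW)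
      (hV _ (div_mem_ball_zero hd hc))
    rw [Units.val_mk0, normAbs_neg, normAbs_inv_eq_one hc]
  by_cases hc : normAbs F (entryC g) = 1
  · exact cell g hg hc
  · have hc' : normAbs F (entryC g) < 1 := lt_of_le_of_ne (mem_ball_zero_iff.1 hg.2.2.1) hc
    have ha : normAbs F (entryA g) = 1 := normAbs_entryA_eq_one hg hc'
    have hg' : weylSp₁⁻¹ * g ∈ integralSp₁ F := (integralSp₁ F).mul_mem ((integralSp₁ F).inv_mem
      weylSp₁_mem_integralSp₁) hg
    have hc'' : normAbs F (entryC (weylSp₁⁻¹ * g)) = 1 := by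
      obtain ⟨w1, w2, w3, w4⟩ := entries_weylSp₁ (F := F)
      rw [entryC_mul, entryC_inv, entryD_inv, w3, w1, neg_neg, one_mul, zero_mul, add_zero, ha]
    have := cell _ hg' hc''
    have e : g = weylSp₁ * (weylSp₁⁻¹ * g) := by rw [mul_inv_cancel_left]
    rw [e]
    exact H.mul_mem hW this

end Integral

/-! ## §3 Pairs fixing a vector -/

section Fixing

variable {R : Type*} [CommRing R] [Invertible (2 : R)] {V : Type*} [AddCommGroup V] [Module R V]
  {B : V →ₗ[R] V →ₗ[R] R} {k : Type*} [CommRing k] {S : Type*} [AddCommGroup S] [Module k S]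
  (ρ : Representation k (Heisenberg B) S) (φ : S)

/-- for any model `ρ` and vector `φ`, the pairs `(g, M) ∈ S̃p_ψ(W)` with `M φ = φ` form a subgroup.
[cite: MoeglinVignerasWaldspurger1987, Chap. 2 II.10] -/
def fixingPairs : Subgroup (symplecticGroup B × (S ≃ₗ[k] S)) where
  carrier := {p | p ∈ MpPsi ρ ∧ p.2 φ = φ}
  mul_mem' := by
    rintro p q ⟨hp, hp'⟩ ⟨hq, hq'⟩
    exact ⟨(MpPsi ρ).mul_mem hp hq, by rw [Prod.snd_mul, LinearEquiv.mul_apply, hq', hp']⟩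
  one_mem' := ⟨(MpPsi ρ).one_mem, rfl⟩
  inv_mem' := by
    rintro p ⟨hp, hp'⟩
    refine ⟨(MpPsi ρ).inv_mem hp, ?_⟩
    rw [Prod.snd_inv, LinearEquiv.coe_inv, LinearEquiv.symm_apply_eq]
    exact hp'.symm

/-- **closure principle for a fixed vector**: if every `g` in a set `T` has an implementer fixing `φ`, so does every
`g` in the subgroup generated by `T`. [cite: MoeglinVignerasWaldspurger1987, Chap. 2 II.10] -/
theorem exists_implementer_fixing_of_mem_closure (T : Set (symplecticGroup B))
    (hT : ∀ g ∈ T, ∃ M : S ≃ₗ[k] S, Implements ρ (ofSymplectic B g) M ∧ M φ = φ)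
    {g : symplecticGroup B} (hg : g ∈ Subgroup.closure T) :
    ∃ M : S ≃ₗ[k] S, Implements ρ (ofSymplectic B g) M ∧ M φ = φ := by
  have hsub : Subgroup.closure T ≤ (fixingPairs ρ φ).map (MonoidHom.fst _ _) := by
    rw [Subgroup.closure_le]
    intro g hg
    obtain ⟨M, hM, hM'⟩ := hT g hg
    exact ⟨(g, M), ⟨(mem_MpPsi ρ _).2 hM, hM'⟩, rfl⟩
  obtain ⟨p, ⟨hp, hp'⟩, hpg⟩ := hsub hg
  refine ⟨p.2, ?_, hp'⟩
  rw [mem_MpPsi] at hp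
  rw [MonoidHom.coe_fst] at hpg
  rw [← hpg]
  exact hp

end Fixing

/-! ## §4 The unramified vector -/

section Unramified

variable {F : Type*} [Field F] [ValuativeRel F] [TopologicalSpace F] [IsNonarchimedeanLocalField F]

local notation "Sp₁" => symplecticGroup (polar (LinearMap.mul F F))
local notation "𝒪₀" => primePowBall F 0

variable (F) in
/-- the **unramified vector** `φ° = 1_𝒪 ∈ 𝒮(F)`. [cite: MoeglinVignerasWaldspurger1987, Chap. 2 II.10] -/
def unramifiedVector : SchwartzBruhat F :=
  ⟨(primePowBall F 0).indicator fun _ => (1 : ℂ), indicator_primePowBall_mem_schwartzBruhat 0 1⟩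

/-- its underlying function. [cite: MoeglinVignerasWaldspurger1987, Chap. 2 II.10] -/
@[simp] theorem coe_unramifiedVector :
    ((unramifiedVector F : SchwartzBruhat F) : F → ℂ) = (primePowBall F 0).indicator fun _ => (1 : ℂ) := rfl

open scoped Classical in
/-- pointwise form. [folklore] -/
theorem unramifiedVector_apply (u : F) :
    ((unramifiedVector F : SchwartzBruhat F) : F → ℂ) u = if u ∈ 𝒪₀ then 1 else 0 := by
  rw [coe_unramifiedVector, Set.indicator_apply]

variable [MeasurableSpace F] [BorelSpace F] (ψ : AddChar F Circle) (μ : Measure F) [μ.IsAddHaarMeasure]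

/-- **a self-dual measure for a conductor-`𝒪` character gives `𝒪` volume one**: apply self-duality to `1_𝒪`,
whose transform is `μ(𝒪)·1_𝒪`, and evaluate at `0`. [cite: Tate1950, §2.2 Thm 2.2.2, §2.5] -/
theorem measureReal_ball_eq_one_of_isSelfDualMeasure (hm : ψ.HasConductorExp 0) (hμ : IsSelfDualMeasure ψ μ) :
    μ.real (primePowBall F 0) = 1 := by
  classical
  have h1 : fourierSB ψ μ ((primePowBall F 0).indicator fun _ => (1 : ℂ))
      = fun y => (μ.real (primePowBall F 0) : ℂ) * (primePowBall F 0).indicator (fun _ => (1 : ℂ)) y := by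
    funext y
    rw [fourierSB_indicator_primePowBall μ hm 0 y, sub_zero, Set.indicator_apply]
    split_ifs <;> simp
  have h2 := hμ _ (indicator_primePowBall_mem_schwartzBruhat 0 1)
  have h3 := congr_fun h2 0
  rw [h1] at h3
  have h4 : fourierSB ψ μ (fun y => (μ.real (primePowBall F 0) : ℂ)
        * (primePowBall F 0).indicator (fun _ => (1 : ℂ)) y) 0
      = (μ.real (primePowBall F 0) : ℂ) * fourierSB ψ μ ((primePowBall F 0).indicator fun _ => (1 : ℂ)) 0 := by
    rw [fourierSB_apply, fourierSB_apply, ← integral_const_mul]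
    refine integral_congr_ae (Filter.Eventually.of_forall fun x => ?_)
    simp only; ring
  simp only [h4, h1, neg_zero, Set.indicator_of_mem (zero_mem_primePowBall 0), mul_one] at h3
  have h6 : μ.real (primePowBall F 0) * μ.real (primePowBall F 0) = 1 := by exact_mod_cast h3
  have hpos : 0 < μ.real (primePowBall F 0) := by
    rw [measureReal_def, ENNReal.toReal_pos_iff]
    exact ⟨(isOpen_primePowBall 0).measure_pos μ ⟨0, zero_mem_primePowBall 0⟩,
      (isCompact_primePowBall 0).measure_lt_top⟩
  nlinarith [h6, hpos, sq_nonneg (μ.real (primePowBall F 0) - 1)]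

variable [Invertible (2 : F)]

/-- **the unramified vector is fixed by `SL₂(𝒪)`**: for `ψ` continuous of conductor `𝒪`, `μ` self-dual and
`⅟2 ∈ 𝒪`, every `g ∈ SL₂(𝒪)` admits an implementer `M ∈ GL(𝒮(F))` (MVW (A)) with `M 1_𝒪 = 1_𝒪`.
[cite: MoeglinVignerasWaldspurger1987, Chap. 2 II.10] -/
theorem exists_implementer_fixing_unramifiedVector (hψ : ψ.IsContinuousNontrivial) (hm : ψ.HasConductorExp 0)
    (hμ : IsSelfDualMeasure ψ μ) (h2 : ⅟(2 : F) ∈ 𝒪₀) {g : Sp₁} (hg : g ∈ integralSp₁ F) :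
    ∃ M : SchwartzBruhat F ≃ₗ[ℂ] SchwartzBruhat F,
      Implements (schrodingerSB (LinearMap.mul F F) ψ (isLocallyConstant_of_isContinuousNontrivial hψ)
        continuous_mul_left_apply) (ofSymplectic _ g) M ∧ M (unramifiedVector F) = unramifiedVector F := by
  classical
  have hψ' := isLocallyConstant_of_isContinuousNontrivial hψ
  have hμ1 := measureReal_ball_eq_one_of_isSelfDualMeasure ψ μ hm hμ
  rw [← closure_integralGenerators_eq] at hg
  refine exists_implementer_fixing_of_mem_closure _ _ (integralGenerators F) ?_ hg
  rintro g ((⟨t, ht, rfl⟩ | ⟨s, hs, rfl⟩) | hg)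
  · -- Levi `m(t)`, `|t| = 1`: `1_𝒪 (t⁻¹ u) = 1_𝒪 u`
    refine ⟨leviEquivSB (LinearEquiv.smulOfUnit t) (continuous_const.mul continuous_id)
      (continuous_const.mul continuous_id), ?_, ?_⟩
    · have h := levi_mem_MpPsi (LinearMap.mul F F) ψ hψ' continuous_mul_left_apply (LinearEquiv.smulOfUnit t)
        (LinearEquiv.smulOfUnit t⁻¹) (mul_smulOfUnit_smulOfUnit_inv t) (continuous_const.mul continuous_id)
        (continuous_const.mul continuous_id)
      rwa [mem_MpPsi] at h
    · apply Subtype.ext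
      rw [coe_leviEquivSB]
      funext u
      rw [leviOp_apply, unramifiedVector_apply, unramifiedVector_apply]
      have e : (LinearEquiv.smulOfUnit t).symm u = ((t⁻¹ : Fˣ) : F) * u := rfl
      rw [e, Units.val_inv_eq_inv_val, unit_mul_mem_ball_zero_iff (normAbs_inv_eq_one ht)]
  · -- unipotent `n(s)`, `s ∈ 𝒪`: `ψ(-½ u s u) = 1` on `𝒪`
    refine ⟨unipotentEquivSB ψ hψ' (fun x : F => ⅟(2 : F) * LinearMap.mul F F x (LinearMap.mulLeft F s x))
      (continuous_const.mul (continuous_id.mul (continuous_const.mul continuous_id))), ?_, ?_⟩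
    · have h := unipotent_mem_MpPsi (LinearMap.mul F F) ψ hψ' continuous_mul_left_apply (LinearMap.mulLeft F s)
        (mul_mulLeft_symm s) (continuous_const.mul (continuous_id.mul (continuous_const.mul continuous_id)))
      rwa [mem_MpPsi] at h
    · apply Subtype.ext
      rw [coe_unipotentEquivSB]
      funext u
      rw [unipotentOp_apply, unramifiedVector_apply]
      split_ifs with hu
      · have hq : -(⅟(2 : F) * LinearMap.mul F F u (LinearMap.mulLeft F s u)) ∈ primePowBall F 0 := by
          rw [LinearMap.mul_apply', LinearMap.mulLeft_apply]
          exact neg_mem_primePowBall (mul_mem_ball_zero h2 (mul_mem_ball_zero hu (mul_mem_ball_zero hs hu)))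
        rw [hm.1 _ hq, Circle.coe_one, mul_one]
      · rw [mul_zero]
  · -- Weyl element: `(1_𝒪)^ = μ(𝒪) 1_𝒪 = 1_𝒪`
    rw [Set.mem_singleton_iff] at hg
    subst hg
    refine ⟨tateWeylEquivSB μ hψ hμ, ?_, ?_⟩
    · rw [weylSp₁, ofSymplectic_weylSp]
      exact tateWeylPair_mem_mpPairs μ hψ hμ
    · apply Subtype.ext
      rw [coe_tateWeylEquivSB, coe_unramifiedVector]
      funext y
      rw [fourierSB_indicator_primePowBall μ hm 0 y, sub_zero, hμ1, Set.indicator_apply]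
      split_ifs <;> simp

end Unramified

end Literature.RepresentationTheory.HeisenbergGroup
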